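import Mathlib
import Summits.Ventures.PercRepro2.CrossAPrimePendantReduce

/-!
# The pendant-mark reduction, II: the rule, and the two unconditional cases `w = v`, `w = a₁`
(blind cell PercRepro2, p5 g37; S4 §2.4 (s) addendum 43)

`CrossAPrimePendantReduce.crossC_pendant_lower_bound` bounds `crossC(p; π)` at the pair `(o, b)`,
for a mark `b` with exactly the edges `f = {b, w}`, `g = {a₂, b}`, from below by
`β(1 − r)(1 − βr)·crossC(p⁰⁰; π)(o, w) + β²r(1 − r)·M_g`.  So
(**`crossA'so_nonneg_of_pendant_reduce`**) `0 ≤ crossA′so` at `(o, b)` follows from the crux at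
`(o, w)` on the graph without `b` and from `M_g ≥ 0`.  For `w = v` both are theorems — the crux at
`(o, v)` is `y·(πx − xv) ≥ 0` (every route mass with `v ∈ K` vanishes) and
`M_g = Z¹¹(πx⁰⁰ − xv⁰⁰) + π·x¹¹·y⁰⁰ ≥ 0` (under `p¹¹` the sure path `a₂–b–v` kills every route
mass); for `w = a₁` both sides vanish (`a₁ ∉ K` on `Q`; under `p¹¹` the sure path `a₂–b–a₁` empties
`Q`).  Hence **`crossA'so_nonneg_of_pendant_mark_at_v`** and
**`crossA'so_nonneg_of_pendant_mark_at_a1`** hold for EVERY graph otherwise; `crossA'so_swap`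
exchanges `o` and `b`, giving the same for `o` hanging off `v`, `a₁` or `b`.  Own work; standard
axioms.
-/

namespace Summit.Ventures.PercRepro2

open LeafRowPendantRootSO CrossAPrimeA2Route CrossAPrimeSupport CrossAPrimeA2Induction
  CrossAPrimeA2VEdge CrossAPrimeIsolatedFlip CrossAPrimeMarkAtV CrossAPrimePendantMark
  CrossAPrimePendantReduce

namespace CrossAPrimePendantReduceCases

section Swap

variable {V : Type*} {E : Type*} [Fintype E] [DecidableEq E] {R : Type*} [Field R]
variable {ends : E → Sym2 V}

/-- `crossA′so` is symmetric in the two marks `o`, `b`. -/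
lemma crossA'so_swap (p : E → R) (o a₁ a₂ v b : V) :
    crossA'so p ends o a₁ a₂ v b = crossA'so p ends b a₁ a₂ v o := by
  unfold crossA'so
  rw [Set.inter_comm (connEvent ends a₂ o) (connEvent ends a₂ b)]
  ring

end Swap

section Cases

variable {V : Type*} {E : Type*} [Fintype E] [DecidableEq E] [Fintype V] [DecidableEq V]
  {R : Type*} [Field R] [LinearOrder R] [IsStrictOrderedRing R]
variable {ends : E → Sym2 V}

omit [DecidableEq V] in
/-- **The pendant-mark reduction rule.**  If the crux holds at the pair `(o, w)` on the graph
without `b` (at the constant `π = P_p(a₁ ↔ v)`) and the mixed coin term is nonnegative, then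
`0 ≤ crossA′so` at the pair `(o, b)`. -/
theorem crossA'so_nonneg_of_pendant_reduce (p : E → R) (hp : IsProbVec p) {f g : E}
    {o a₁ a₂ v b w : V} (hf : ends f = s(b, w)) (hg : ends g = s(a₂, b))
    (hb : ∀ e, b ∈ ends e → e = f ∨ e = g) (hfg : f ≠ g)
    (hba₁ : a₁ ≠ b) (hba₂ : a₂ ≠ b) (hbo : o ≠ b) (hbv : v ≠ b) (hbw : w ≠ b)
    (hcrux : 0 ≤ crossC (Function.update (Function.update p f 0) g 0)
      (prob p (connEvent ends a₁ v)) ends o a₁ a₂ v w)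
    (hmixed : 0 ≤ crossPatC (Function.update (Function.update p f 1) g 0)
        (Function.update (Function.update p f 1) g 1) (prob p (connEvent ends a₁ v))
        ends o a₁ a₂ v b +
      crossPatC (Function.update (Function.update p f 1) g 1)
        (Function.update (Function.update p f 1) g 0) (prob p (connEvent ends a₁ v))
        ends o a₁ a₂ v b) :
    0 ≤ crossA'so p ends o a₁ a₂ v b := by
  rw [crossA'so_eq_crossC]
  refine le_trans ?_ (crossC_pendant_lower_bound (ends := ends) p hp hf hg hb hfg hba₁ hba₂ hbo
    hbv hbw)
  have hβ0 : 0 ≤ p f := hp.nonneg f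
  have hr0 : 0 ≤ p g := hp.nonneg g
  have hr1 : 0 ≤ 1 - p g := by linarith [hp.le_one g]
  have hβr : 0 ≤ 1 - p f * p g := by nlinarith [hp.le_one f, hp.le_one g]
  have t1 : 0 ≤ p f * (1 - p g) * (1 - p f * p g) *
      crossC (Function.update (Function.update p f 0) g 0) (prob p (connEvent ends a₁ v))
        ends o a₁ a₂ v w :=
    mul_nonneg (mul_nonneg (mul_nonneg hβ0 hr1) hβr) hcrux
  have t2 := mul_nonneg (mul_nonneg (sq_nonneg (p f)) (mul_nonneg hr0 hr1)) hmixed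
  linarith

omit [Fintype V] [DecidableEq V] [LinearOrder R] [IsStrictOrderedRing R] in
/-- On the support of `p[f ↦ 1][g ↦ 1]` with `f = {b, v}`, `g = {a₂, b}`: `a₂ ↔ v` surely, so the
route masses vanish. -/
lemma prob_f1g1_Q_L_eq_zero (p : E → R) {f g : E} {a₁ a₂ v b : V} (hf : ends f = s(b, v))
    (hg : ends g = s(a₂, b)) (hfg : f ≠ g) (A : Set (Config E)) :
    prob (Function.update (Function.update p f 1) g 1)
      (avoidAll ends a₂ {a₁} ∩ (connEvent ends a₁ v ∩ A)) = 0 := by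
  rw [← prob_inter_supp]
  have : avoidAll ends a₂ {a₁} ∩ (connEvent ends a₁ v ∩ A) ∩
      supp (Function.update (Function.update p f 1) g 1) = ∅ := by
    ext ω
    refine ⟨fun h => ?_, fun h => absurd h (Set.notMem_empty ω)⟩
    obtain ⟨⟨hQ, hL, -⟩, hs⟩ := h
    have hav : Conn ends ω a₂ v := by
      refine conn_trans (conn_of_openAdj ⟨g, (hs g).1 (by simp), hg⟩)
        (conn_of_openAdj ⟨f, (hs f).1 ?_, hf⟩)
      rw [Function.update_of_ne hfg, Function.update_self]
    exact (hQ a₁ (Finset.mem_singleton_self a₁) (conn_trans hav (conn_symm hL))).elim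
  rw [this, prob_empty]

omit [DecidableEq V] in
/-- **A mark hanging off `v`**: `b` has exactly the edges `f = {b, v}` and the coin `g = {a₂, b}`;
then `0 ≤ crossA′so` for every graph otherwise. -/
theorem crossA'so_nonneg_of_pendant_mark_at_v (p : E → R) (hp : IsProbVec p) {f g : E}
    {o a₁ a₂ v b : V} (hf : ends f = s(b, v)) (hg : ends g = s(a₂, b))
    (hb : ∀ e, b ∈ ends e → e = f ∨ e = g) (hfg : f ≠ g)
    (hba₁ : a₁ ≠ b) (hba₂ : a₂ ≠ b) (hbo : o ≠ b) (hbv : v ≠ b) :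
    0 ≤ crossA'so p ends o a₁ a₂ v b := by
  classical
  refine crossA'so_nonneg_of_pendant_reduce (ends := ends) p hp hf hg hb hfg hba₁ hba₂ hbo hbv hbv
    ?_ ?_
  · -- the crux at `(o, v)` on the graph without `b`: `y·(π x − xv) ≥ 0`
    set p00 := Function.update (Function.update p f 0) g 0 with hp00
    have hq00 : IsProbVec p00 := (hp.update f le_rfl zero_le_one).update g le_rfl zero_le_one
    obtain ⟨h0, hD⟩ := prob_Q_L_vH_eq_zero (ends := ends) p00 a₁ a₂ v
    have hxv := prob_Q_L_le (ends := ends) p00 hq00 (adm_pi_f0g0 (ends := ends) p hp f g a₁ a₂ v) o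
    have hy : 0 ≤ prob p00 (avoidAll ends a₂ {a₁} ∩ connEvent ends a₂ v) := prob_nonneg hq00 _
    unfold crossC
    rw [Q_L_swap, hD o, h0]
    nlinarith [mul_le_mul_of_nonneg_left hxv hy]
  · -- the mixed coin term: every route mass of `p¹¹` vanishes and `D⁰⁰ = yv⁰⁰ = 0`
    set p00 := Function.update (Function.update p f 0) g 0 with hp00
    set p10 := Function.update (Function.update p f 1) g 0 with hp10
    set p11 := Function.update (Function.update p f 1) g 1 with hp11
    have hq00 : IsProbVec p00 := (hp.update f le_rfl zero_le_one).update g le_rfl zero_le_one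
    have hq10 : IsProbVec p10 := (hp.update f zero_le_one le_rfl).update g le_rfl zero_le_one
    have hq11 : IsProbVec p11 := (hp.update f zero_le_one le_rfl).update g zero_le_one le_rfl
    have z1 := prob_f1g1_Q_L_eq_zero (ends := ends) (a₁ := a₁) p hf hg hfg (connEvent ends a₂ o)
    have z2 := prob_f1g1_Q_L_eq_zero (ends := ends) (a₁ := a₁) p hf hg hfg
      (connEvent ends a₂ o ∩ connEvent ends a₂ b)
    have z3 := prob_f1g1_Q_L_eq_zero (ends := ends) (a₁ := a₁) p hf hg hfg (connEvent ends a₂ b)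
    obtain ⟨-, hD10⟩ := prob_Q_L_vH_eq_zero (ends := ends) p10 a₁ a₂ v
    have hyv10 : prob p10 (avoidAll ends a₂ {a₁} ∩ (connEvent ends a₁ v ∩ connEvent ends a₂ b)) = 0 := by
      rw [← Set.inter_assoc, prob_f1g0_bH_eq_wH (ends := ends) p hf hfg, Set.inter_assoc]
      exact (prob_Q_L_vH_eq_zero (ends := ends) p10 a₁ a₂ v).1
    have hD10' : prob p10 (avoidAll ends a₂ {a₁} ∩
        (connEvent ends a₁ v ∩ (connEvent ends a₂ o ∩ connEvent ends a₂ b))) = 0 := by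
      rw [← Set.inter_assoc, ← Set.inter_assoc, prob_f1g0_bH_eq_wH (ends := ends) p hf hfg,
        Set.inter_assoc, Set.inter_assoc, Q_L_swap]
      exact hD10 o
    have hm10 : ∀ A : Set (Config E), (∀ ω : Config E, (∀ e, b ∈ ends e → ω e = false) →
        (Function.update ω f true ∈ A ↔ ω ∈ A)) → prob p10 A = prob p00 A :=
      fun A hA => prob_g0f1_eq_g0f0 (ends := ends) p hb hfg A hA
    have flipf : ∀ ω : Config E, (∀ e, b ∈ ends e → ω e = false) →
        ((Function.update ω f true ∈ avoidAll ends a₂ {a₁} ↔ ω ∈ avoidAll ends a₂ {a₁}) ∧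
          (Function.update ω f true ∈ connEvent ends a₂ o ↔ ω ∈ connEvent ends a₂ o) ∧
          (Function.update ω f true ∈ connEvent ends a₁ v ↔ ω ∈ connEvent ends a₁ v) ∧
          (Function.update ω f true ∈ connEvent ends a₂ v ↔ ω ∈ connEvent ends a₂ v)) :=
      fun ω hiso => flipf_iff_of_isolated (o := o) (v := v) (a₂ := a₂) hf hiso hba₁ hba₂ hbo hbv hbv
    have hx10 : prob p10 (avoidAll ends a₂ {a₁} ∩ connEvent ends a₂ o) =
        prob p00 (avoidAll ends a₂ {a₁} ∩ connEvent ends a₂ o) :=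
      hm10 _ (fun ω hiso => by simp only [Set.mem_inter_iff, (flipf ω hiso).1, (flipf ω hiso).2.1])
    have hxv10 : prob p10 (avoidAll ends a₂ {a₁} ∩ (connEvent ends a₁ v ∩ connEvent ends a₂ o)) =
        prob p00 (avoidAll ends a₂ {a₁} ∩ (connEvent ends a₁ v ∩ connEvent ends a₂ o)) :=
      hm10 _ (fun ω hiso => by
        simp only [Set.mem_inter_iff, (flipf ω hiso).1, (flipf ω hiso).2.1, (flipf ω hiso).2.2.1])
    have hxvπ : prob p00 (avoidAll ends a₂ {a₁} ∩ (connEvent ends a₁ v ∩ connEvent ends a₂ o)) ≤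
        prob p (connEvent ends a₁ v) * prob p00 (avoidAll ends a₂ {a₁} ∩ connEvent ends a₂ o) :=
      prob_Q_L_le (ends := ends) p00 hq00 (adm_pi_f0g0 (ends := ends) p hp f g a₁ a₂ v) o
    have hy11 : 0 ≤ prob p11 (avoidAll ends a₂ {a₁} ∩ connEvent ends a₂ b) := prob_nonneg hq11 _
    have hx11 : 0 ≤ prob p11 (avoidAll ends a₂ {a₁} ∩ connEvent ends a₂ o) := prob_nonneg hq11 _
    have hy10 : 0 ≤ prob p10 (avoidAll ends a₂ {a₁} ∩ connEvent ends a₂ b) := prob_nonneg hq10 _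
    have hπ : 0 ≤ prob p (connEvent ends a₁ v) := prob_nonneg hp _
    unfold crossPatC
    rw [z1, z2, z3, hyv10, hD10', hx10, hxv10]
    nlinarith [mul_le_mul_of_nonneg_left hxvπ hy11, mul_nonneg hπ (mul_nonneg hx11 hy10)]

omit [Fintype V] [DecidableEq V] [LinearOrder R] [IsStrictOrderedRing R] in
/-- `Q ∩ A ∩ {a₁ ∈ K} = ∅`. -/
lemma prob_Q_a1H_eq_zero (p : E → R) (a₁ a₂ : V) (A : Set (Config E)) :
    prob p (avoidAll ends a₂ {a₁} ∩ (A ∩ connEvent ends a₂ a₁)) = 0 := by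
  have : avoidAll ends a₂ {a₁} ∩ (A ∩ connEvent ends a₂ a₁) = ∅ := by
    ext ω
    simp only [Set.mem_inter_iff, Set.mem_empty_iff_false, iff_false, not_and]
    intro hQ _ hc
    exact hQ a₁ (Finset.mem_singleton_self a₁) hc
  rw [this, prob_empty]

omit [DecidableEq V] in
/-- **A mark hanging off `a₁`**: `b` has exactly the edges `f = {b, a₁}` and the coin `g = {a₂, b}`;
then `0 ≤ crossA′so` for every graph otherwise. -/
theorem crossA'so_nonneg_of_pendant_mark_at_a1 (p : E → R) (hp : IsProbVec p) {f g : E}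
    {o a₁ a₂ v b : V} (hf : ends f = s(b, a₁)) (hg : ends g = s(a₂, b))
    (hb : ∀ e, b ∈ ends e → e = f ∨ e = g) (hfg : f ≠ g)
    (hba₁ : a₁ ≠ b) (hba₂ : a₂ ≠ b) (hbo : o ≠ b) (hbv : v ≠ b) :
    0 ≤ crossA'so p ends o a₁ a₂ v b := by
  classical
  refine crossA'so_nonneg_of_pendant_reduce (ends := ends) p hp hf hg hb hfg hba₁ hba₂ hbo hbv hba₁
    ?_ ?_
  · -- the crux at `(o, a₁)` on the graph without `b` vanishes
    set p00 := Function.update (Function.update p f 0) g 0 with hp00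
    have h1 := prob_Q_a1H_eq_zero (ends := ends) p00 a₁ a₂ Set.univ
    have h2 := prob_Q_a1H_eq_zero (ends := ends) p00 a₁ a₂ (connEvent ends a₁ v)
    have h3 := prob_Q_a1H_eq_zero (ends := ends) p00 a₁ a₂
      (connEvent ends a₁ v ∩ connEvent ends a₂ o)
    rw [Set.univ_inter] at h1
    rw [Set.inter_assoc] at h3
    unfold crossC
    rw [h1, h2, h3]
    ring_nf
    exact le_refl 0
  · -- the mixed coin term vanishes: `p¹¹` has `a₂ ↔ a₁` surely, and `a₁ ∉ K` on `Q`
    set p10 := Function.update (Function.update p f 1) g 0 with hp10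
    set p11 := Function.update (Function.update p f 1) g 1 with hp11
    have hQ11 : ∀ A : Set (Config E), prob p11 (avoidAll ends a₂ {a₁} ∩ A) = 0 := by
      intro A
      rw [← prob_inter_supp]
      have : avoidAll ends a₂ {a₁} ∩ A ∩ supp p11 = ∅ := by
        ext ω
        refine ⟨fun h => ?_, fun h => absurd h (Set.notMem_empty ω)⟩
        obtain ⟨⟨hQ, -⟩, hs⟩ := h
        have hav : Conn ends ω a₂ a₁ := by
          refine conn_trans (conn_of_openAdj ⟨g, (hs g).1 (by rw [hp11]; simp), hg⟩)
            (conn_of_openAdj ⟨f, (hs f).1 ?_, hf⟩)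
          rw [hp11, Function.update_of_ne hfg, Function.update_self]
        exact (hQ a₁ (Finset.mem_singleton_self a₁) hav).elim
      rw [this, prob_empty]
    have hZ11 : prob p11 (avoidAll ends a₂ {a₁}) = 0 := by
      have := hQ11 Set.univ
      rwa [Set.inter_univ] at this
    have hy10 : prob p10 (avoidAll ends a₂ {a₁} ∩ connEvent ends a₂ b) = 0 := by
      rw [prob_f1g0_bH_eq_wH (ends := ends) p hf hfg]
      have := prob_Q_a1H_eq_zero (ends := ends) p10 a₁ a₂ Set.univ
      rwa [Set.univ_inter] at this
    have hyv10 : prob p10 (avoidAll ends a₂ {a₁} ∩ (connEvent ends a₁ v ∩ connEvent ends a₂ b)) = 0 := by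
      rw [← Set.inter_assoc, prob_f1g0_bH_eq_wH (ends := ends) p hf hfg, Set.inter_assoc]
      exact prob_Q_a1H_eq_zero (ends := ends) p10 a₁ a₂ _
    have hD10 : prob p10 (avoidAll ends a₂ {a₁} ∩
        (connEvent ends a₁ v ∩ (connEvent ends a₂ o ∩ connEvent ends a₂ b))) = 0 := by
      rw [← Set.inter_assoc, ← Set.inter_assoc, prob_f1g0_bH_eq_wH (ends := ends) p hf hfg,
        Set.inter_assoc (avoidAll ends a₂ {a₁}) (connEvent ends a₁ v) (connEvent ends a₂ o),
        Set.inter_assoc]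
      exact prob_Q_a1H_eq_zero (ends := ends) p10 a₁ a₂ _
    unfold crossPatC
    rw [hZ11, hQ11, hQ11, hQ11, hQ11, hQ11, hy10, hyv10, hD10]
    ring_nf
    exact le_refl 0

omit [DecidableEq V] in
/-- The swapped form: `o` hanging off `v` through a coin-bridge. -/
theorem crossA'so_nonneg_of_pendant_o_at_v (p : E → R) (hp : IsProbVec p) {f g : E}
    {o a₁ a₂ v b : V} (hf : ends f = s(o, v)) (hg : ends g = s(a₂, o))
    (ho : ∀ e, o ∈ ends e → e = f ∨ e = g) (hfg : f ≠ g)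
    (hoa₁ : a₁ ≠ o) (hoa₂ : a₂ ≠ o) (hob : b ≠ o) (hov : v ≠ o) :
    0 ≤ crossA'so p ends o a₁ a₂ v b := by
  rw [crossA'so_swap]
  exact crossA'so_nonneg_of_pendant_mark_at_v (ends := ends) p hp hf hg ho hfg hoa₁ hoa₂ hob hov

omit [DecidableEq V] in
/-- The swapped form: `o` hanging off `a₁` through a coin-bridge. -/
theorem crossA'so_nonneg_of_pendant_o_at_a1 (p : E → R) (hp : IsProbVec p) {f g : E}
    {o a₁ a₂ v b : V} (hf : ends f = s(o, a₁)) (hg : ends g = s(a₂, o))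
    (ho : ∀ e, o ∈ ends e → e = f ∨ e = g) (hfg : f ≠ g)
    (hoa₁ : a₁ ≠ o) (hoa₂ : a₂ ≠ o) (hob : b ≠ o) (hov : v ≠ o) :
    0 ≤ crossA'so p ends o a₁ a₂ v b := by
  rw [crossA'so_swap]
  exact crossA'so_nonneg_of_pendant_mark_at_a1 (ends := ends) p hp hf hg ho hfg hoa₁ hoa₂ hob hov

omit [DecidableEq V] in
/-- The swapped form of `CrossAPrimePendantMark`: `o` hanging off `b` through a coin-bridge. -/
theorem crossA'so_nonneg_of_pendant_o_at_b (p : E → R) (hp : IsProbVec p) {f g : E}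
    {o a₁ a₂ v b : V} (hf : ends f = s(o, b)) (hg : ends g = s(a₂, o))
    (ho : ∀ e, o ∈ ends e → e = f ∨ e = g) (hfg : f ≠ g)
    (hoa₁ : a₁ ≠ o) (hoa₂ : a₂ ≠ o) (hob : b ≠ o) (hov : v ≠ o) :
    0 ≤ crossA'so p ends o a₁ a₂ v b := by
  rw [crossA'so_swap]
  exact crossA'so_nonneg_of_pendant_mark (ends := ends) p hp hf hg ho hfg hoa₁ hoa₂ hob hov

end Cases

end CrossAPrimePendantReduceCases

end Summit.Ventures.PercRepro2
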